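import Mathlib.Algebra.Field.ULift
import Mathlib.Algebra.Module.ULift
import Mathlib.Algebra.Algebra.Basic
import Literature.AnabelianGeometry.AbsoluteAnabelian.AbsTopIII.KummerFaithfulPadicAbelianProofs
import Literature.AnabelianGeometry.AbsoluteAnabelian.AbsTopIII.KummerFaithfulBaseChangeProofs
import Literature.AnabelianGeometry.AbsoluteAnabelian.AbsTopIII.KummerPUSchemaNegative
import Literature.AnabelianGeometry.AbsoluteAnabelian.AbsTopIII.KummerIntrinsicSchemaNegative
import HarnessLib

/-!
# [AbsTopIII] Def. 1.5 / Rmk. 1.5.4 (i): consequences of "`ℚ_p` is Kummer-faithful"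
# (proof-only companion of `KummerFaithful.lean`)

Mochizuki, *Topics in Absolute Anabelian Geometry III*, §1, Def. 1.5 p. 32, Rmk. 1.5.3 (i) p. 33,
Rmk. 1.5.4 (i) p. 33 (manuscript pagination, lit key `paper:url-5493eb38cbb7`).  Cell abc-iut, F
fact-proving wave (abc-iut-f-085), FACT-LIST row **F-0369** `Rmk_1_5_4_i` and the schema rows refuted
"modulo F-0369".

`KummerFaithfulPadicAbelianProofs.lean` proved `isKummerFaithful_of_finite_padic` (every finite
extension of `ℚ_p` is Kummer-faithful, unconditionally) and `KummerFaithfulBaseChangeProofs.lean`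
proved `IsKummerFaithful.of_ringHom` (Kummer-faithfulness descends along field embeddings, Rmk. 1.5.4
(i) "by base-change").  This file draws the consequences:

* **Kummer-faithful fields in every universe**: `isKummerFaithful_ulift_padic`
  (`ULift.{u} ℚ_p`, a rank-one extension of `ℚ_p`), `exists_isKummerFaithful_univ`,
  `not_forall_not_isKummerFaithful_univ`;
* **`ℚ` is Kummer-faithful**: `isKummerFaithful_rat` (via `isKummerFaithful_rat_of_padic`; number fields and
  fields embedding in a finite extension of `ℚ_p` are in the sibling `KummerFaithfulNumberFieldProofs.lean`);
* **absolute refutations, in EVERY universe**, of the universe-polymorphic schema closures refuted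
  "modulo F-0369" over `IntrinsicKummerModel.{u}` (files `KummerPUSchemaNegative`,
  `KummerIntrinsicSchemaNegative`): `IntrinsicKummerModel.not_forall_prop_1_8_i` (F-0379),
  `IntrinsicKummerModel.not_forall_prop_1_8_ii` (F-0380) — this seat's tranche-85 rows — and
  `IntrinsicKummerModel.not_forall_prop_1_6_i'` / `…_1_6_iii_units'` / `…_1_8_i_units'` / `…_1_8_ii_units'`
  (F-0374–F-0377; the universe-`0` instances, together with F-0342–F-0345 and F-0351, are recorded in the
  sibling `KummerSchemataClosureRefutations.lean`, abc-iut-f-078) — the hypothesis `IsKummerFaithful k` of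
  the landed conditional versions is discharged by `isKummerFaithful_ulift_padic 2`.

All declarations are theorems; no definition; frozen statement files are imported, not edited.  HONEST
SCOPE: `Rmk_1_5_4_i` in full generality (transcendental sub-`p`-adic fields such as `ℚ_p(t)`) is NOT
proved; the refuted statements are universal closures of SCHEMATA over free model data (refuted-as-schema
≠ refuted-in-print; the instance forms at coherent models are Mochizuki's propositions, untouched).
Nothing here bears on [IUTchIII] Cor. 3.12.
-/

noncomputable section

namespace Literature.AnabelianGeometry.AbsoluteAnabelian.AbsTopIII

universe u

open Literature.AlgebraicGeometry.Motives

/-! ### Kummer-faithful fields in every universe -/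

/-- **`ULift ℚ_p` is Kummer-faithful** (a rank-one, hence finite, extension of `ℚ_p` living in an
arbitrary universe `u`): Kummer-faithful fields exist in every universe.
[cite: MochizukiAbsTopIII2015, Rmk 1.5.4 (i) p.33] -/
theorem isKummerFaithful_ulift_padic (p : ℕ) [Fact p.Prime] :
    IsKummerFaithful (ULift.{u} ℚ_[p]) := by
  haveI : FiniteDimensional ℚ_[p] (ULift.{u} ℚ_[p]) :=
    Module.Finite.equiv (ULift.moduleEquiv : ULift.{u} ℚ_[p] ≃ₗ[ℚ_[p]] ℚ_[p]).symm
  exact isKummerFaithful_of_finite_padic p (ULift.{u} ℚ_[p])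

/-- **A Kummer-faithful field exists in every universe** (`ULift ℚ_2`).
[cite: MochizukiAbsTopIII2015, Rmk 1.5.4 (i) p.33] -/
theorem exists_isKummerFaithful_univ : ∃ (k : Type u) (_ : Field k), IsKummerFaithful k :=
  haveI : Fact (Nat.Prime 2) := ⟨Nat.prime_two⟩
  ⟨ULift.{u} ℚ_[2], inferInstance, isKummerFaithful_ulift_padic 2⟩

/-- The right-hand side «no Kummer-faithful field exists» of the campaign's schema classifications
(`forall_prop_1_8_i_iff`, …) is FALSE in every universe. [cite: MochizukiAbsTopIII2015, Rmk 1.5.4 (i) p.33] -/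
theorem not_forall_not_isKummerFaithful_univ : ¬ ∀ (k : Type u) [Field k], ¬ IsKummerFaithful k := by
  intro h
  obtain ⟨k, _, hk⟩ := exists_isKummerFaithful_univ.{u}
  exact h k hk

/-! ### `ℚ` is Kummer-faithful -/

/-- **`ℚ` is Kummer-faithful** (it embeds into the Kummer-faithful field `ℚ_2`; Rmk. 1.5.4 (i) p. 33).
Unconditional. [cite: MochizukiAbsTopIII2015, Rmk 1.5.4 (i) p.33] -/
theorem isKummerFaithful_rat : IsKummerFaithful ℚ :=
  haveI : Fact (Nat.Prime 2) := ⟨Nat.prime_two⟩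
  isKummerFaithful_rat_of_padic 2 (isKummerFaithful_padic 2)

/-! ### Absolute refutations of the schema closures refuted "modulo F-0369" -/

namespace IntrinsicKummerModel

/-- **F-0379, universal closure REFUTED (absolutely, every universe)**: `¬ ∀ M, Prop_1_8_i M` — the
hypothesis `IsKummerFaithful k` of `not_forall_prop_1_8_i_of_isKummerFaithful` is met by `ULift ℚ_2`.
Refuted-as-schema; the instance form at a coherent model is untouched.
[cite: MochizukiAbsTopIII2015, Prop 1.8 (i) p.36] -/
theorem not_forall_prop_1_8_i : ¬ ∀ M : IntrinsicKummerModel.{u}, M.Prop_1_8_i :=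
  haveI : Fact (Nat.Prime 2) := ⟨Nat.prime_two⟩
  not_forall_prop_1_8_i_of_isKummerFaithful (isKummerFaithful_ulift_padic.{u} 2)

/-- **F-0380, universal closure REFUTED (absolutely, every universe)**: `¬ ∀ M, Prop_1_8_ii M`.
Refuted-as-schema. [cite: MochizukiAbsTopIII2015, Prop 1.8 (ii) p.36] -/
theorem not_forall_prop_1_8_ii : ¬ ∀ M : IntrinsicKummerModel.{u}, M.Prop_1_8_ii :=
  haveI : Fact (Nat.Prime 2) := ⟨Nat.prime_two⟩
  not_forall_prop_1_8_ii_of_isKummerFaithful (isKummerFaithful_ulift_padic.{u} 2)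

/-- **F-0374 (`IntrinsicKummerModel.Prop_1_6_i`), universal closure REFUTED absolutely** (every
universe). Refuted-as-schema. [cite: MochizukiAbsTopIII2015, Prop 1.6 (i) p.34] -/
theorem not_forall_prop_1_6_i' :
    ¬ ∀ M : IntrinsicKummerModel.{u},
        Literature.AnabelianGeometry.AbsoluteAnabelian.AbsTopIII.IntrinsicKummerModel.Prop_1_6_i M :=
  haveI : Fact (Nat.Prime 2) := ⟨Nat.prime_two⟩
  not_forall_prop_1_6_i_of_isKummerFaithful (isKummerFaithful_ulift_padic.{u} 2)

/-- **F-0375 (`IntrinsicKummerModel.Prop_1_6_iii_units`), universal closure REFUTED absolutely**.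
Refuted-as-schema. [cite: MochizukiAbsTopIII2015, Prop 1.6 (iii) p.35] -/
theorem not_forall_prop_1_6_iii_units' :
    ¬ ∀ M : IntrinsicKummerModel.{u},
        Literature.AnabelianGeometry.AbsoluteAnabelian.AbsTopIII.IntrinsicKummerModel.Prop_1_6_iii_units
          M :=
  haveI : Fact (Nat.Prime 2) := ⟨Nat.prime_two⟩
  not_forall_prop_1_6_iii_units_of_isKummerFaithful (isKummerFaithful_ulift_padic.{u} 2)

/-- **F-0376 (`IntrinsicKummerModel.Prop_1_8_i_units`), universal closure REFUTED absolutely**.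
Refuted-as-schema. [cite: MochizukiAbsTopIII2015, Prop 1.8 (i) p.36] -/
theorem not_forall_prop_1_8_i_units' :
    ¬ ∀ M : IntrinsicKummerModel.{u},
        Literature.AnabelianGeometry.AbsoluteAnabelian.AbsTopIII.IntrinsicKummerModel.Prop_1_8_i_units
          M :=
  haveI : Fact (Nat.Prime 2) := ⟨Nat.prime_two⟩
  not_forall_prop_1_8_i_units_of_isKummerFaithful (isKummerFaithful_ulift_padic.{u} 2)

/-- **F-0377 (`IntrinsicKummerModel.Prop_1_8_ii_units`), universal closure REFUTED absolutely**.
Refuted-as-schema. [cite: MochizukiAbsTopIII2015, Prop 1.8 (ii) p.36] -/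
theorem not_forall_prop_1_8_ii_units' :
    ¬ ∀ M : IntrinsicKummerModel.{u},
        Literature.AnabelianGeometry.AbsoluteAnabelian.AbsTopIII.IntrinsicKummerModel.Prop_1_8_ii_units
          M :=
  haveI : Fact (Nat.Prime 2) := ⟨Nat.prime_two⟩
  not_forall_prop_1_8_ii_units_of_isKummerFaithful (isKummerFaithful_ulift_padic.{u} 2)

end IntrinsicKummerModel

end Literature.AnabelianGeometry.AbsoluteAnabelian.AbsTopIII

end
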